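import Summits.CriticalPhenomena.SAWScalingLimit.Theses.SAWParafermion
import Summits.CriticalPhenomena.SAWScalingLimit.Theses.SAWRenewalTightness
import Summits.CriticalPhenomena.SAWScalingLimit.Theorems.SubseqIdentification.Negative.EndpointLoadBearing
import Summits.CriticalPhenomena.SAWScalingLimit.Theorems.SubseqIdentification.Negative.Necessity
import Summits.CriticalPhenomena.SAWScalingLimit.Theorems.SubseqIdentification.Negative.ProbabilityRedundant
import Summits.CriticalPhenomena.SAWScalingLimit.Theorems.SAWRenewalTightnessSubseqIdentificationReferenceWindow
import Summits.CriticalPhenomena.SAWScalingLimit.Theorems.SAWRenewalTightnessSubseqIdentificationAreaLawOfLimit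
import Summits.CriticalPhenomena.SAWScalingLimit.Theorems.SAWRenewalTightnessSubseqIdentificationKappaPinHalfPlane
import Summits.CriticalPhenomena.SAWScalingLimit.Theorems.SAWRenewalTightnessSubseqIdentificationWindowTransport
import Summits.CriticalPhenomena.SAWScalingLimit.Theorems.SAWRenewalTightnessSubseqIdentificationKappaPinGlue
import Summits.CriticalPhenomena.SAWScalingLimit.Theorems.SAWRenewalTightnessSubseqIdentificationBoundaryAreaLawReduction
import Summits.CriticalPhenomena.SAWScalingLimit.Theorems.SAWRenewalTightnessSubseqIdentificationSleHalfPlaneAreaLaw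
import Summits.CriticalPhenomena.SAWScalingLimit.Theorems.SAWRenewalTightnessSubseqIdentificationSleAreaLawGlue
import Summits.CriticalPhenomena.SAWScalingLimit.Theorems.SAWRenewalTightnessSubseqIdentificationLatticeAreaLawOfLimitLaw
import Summits.CriticalPhenomena.SAWScalingLimit.Theorems.SAWRenewalTightnessSubseqIdentificationLatticeAreaLawNecessityGlue
import Summits.CriticalPhenomena.SAWScalingLimit.Theorems.SAWRenewalTightnessSubseqIdentificationDockOfCrux
import Summits.CriticalPhenomena.SAWScalingLimit.Theorems.EventualTight.Negative.TightnessNecessary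
import Summits.CriticalPhenomena.SAWScalingLimit.Theorems.SAWRenewalTightnessSubseqIdentificationHalfBallSubdomain
import Summits.CriticalPhenomena.SAWScalingLimit.Theorems.SAWRenewalTightnessSubseqIdentificationHalfBallNesting
import Summits.CriticalPhenomena.SAWScalingLimit.Theorems.SAWRenewalTightnessSubseqIdentificationAreaUpperOfLimit
import Summits.CriticalPhenomena.SAWScalingLimit.Theorems.SAWRenewalTightnessSubseqIdentificationKappaLeOfUpper
import Summits.CriticalPhenomena.SAWScalingLimit.Theorems.SAWRenewalTightnessSubseqIdentificationRestrictionPassage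
import Summits.CriticalPhenomena.SAWScalingLimit.Theorems.SAWRenewalTightnessSubseqIdentificationSleRestrictionConsistency
import Summits.CriticalPhenomena.SAWScalingLimit.Theorems.SAWRenewalTightnessSubseqIdentificationSleAvoidancePositive
import Summits.CriticalPhenomena.SAWScalingLimit.Theorems.SAWRenewalTightnessSubseqIdentificationSleRestrictionTransport
import Literature.Probability.RandomPlanarGeometry.SLEBubblesThm65Kappa
import Summits.CriticalPhenomena.SAWScalingLimit.Theorems.SAWRenewalTightnessSubseqIdentificationSleAvoidProduct
import Summits.CriticalPhenomena.SAWScalingLimit.Theorems.SAWRenewalTightnessSubseqIdentificationThm65TiltedAssembly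
import Summits.CriticalPhenomena.SAWScalingLimit.Theorems.SAWRenewalTightnessSubseqIdentificationCompensatorReduction
import Summits.CriticalPhenomena.SAWScalingLimit.Theorems.SAWRenewalTightnessSubseqIdentificationTiltedMartingalesAssembly
import Summits.CriticalPhenomena.SAWScalingLimit.Theorems.SAWRenewalTightnessSubseqIdentificationTiltedProductMartingale
import Summits.CriticalPhenomena.SAWScalingLimit.Theorems.SAWRenewalTightnessSubseqIdentificationTiltedBracketMartingale
import Summits.CriticalPhenomena.SAWScalingLimit.Theorems.SAWRenewalTightnessSubseqIdentificationRigidityOfLawParts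
import Summits.CriticalPhenomena.SAWScalingLimit.Theorems.SAWRenewalTightnessSubseqIdentificationRigidityOfLawPartsAvoid
import Summits.CriticalPhenomena.SAWScalingLimit.Theorems.SAWRenewalTightnessSubseqIdentificationTiltedLawIdentity
import Summits.CriticalPhenomena.SAWScalingLimit.Theorems.SAWRenewalTightnessSubseqIdentificationCompensatorFactorsAvoidance
import Literature.Probability.RandomPlanarGeometry.RestrictionHullsProofs
import Summits.CriticalPhenomena.SAWScalingLimit.Theorems.SAWRenewalTightnessSubseqIdentificationSteeringVertical
import Summits.CriticalPhenomena.SAWScalingLimit.Theorems.SAWRenewalTightnessSubseqIdentificationSteeringArc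
import Summits.CriticalPhenomena.SAWScalingLimit.Theorems.SAWRenewalTightnessSubseqIdentificationCompensatorTube
import Summits.CriticalPhenomena.SAWScalingLimit.Theorems.SAWRenewalTightnessSubseqIdentificationEssUnboundedOfTube
import Summits.CriticalPhenomena.SAWScalingLimit.Theorems.SAWRenewalTightnessSubseqIdentificationSleRestrictionRigidityBelow
import HarnessLib

/-!
# The restriction composition of line `boundary-area-law`, in the tree:
# `SubseqIdentification ⇐ IdentificationUpToKappa (S1) ∧ LatticeAreaUpperBound (S4⁺) ∧ EventualTight (T′)`

Crux `SubseqIdentification` (stmt-CriticalPhenomena-0783). This file lands the COMPOSITION of the restriction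
reshape of line `boundary-area-law` (lead c4 r-c4-1…8, lead c5 r-c5-1…3; until now only in the crux workfile
`Cruxes/SubseqIdentification/Lines/boundary_area_law.lean`) as a theorem of the tree, with EVERY SLE-side and
every provable lattice-side input discharged by the landed stub files: S2 `stub_referenceWindow` (p96552),
T′-extraction `subseqLimitsExist_of_eventualTight`, S5⁺ `stub_areaUpperOfLimit`, S6⁺ `stub_kappaLeOfUpper`,
RS2a `stub_halfBallSubdomain`, RS2b `stub_halfBallNesting`, RS3 `stub_restrictionPassage` (lead c4, cycle 1) and
RS5 `stub_sleRestrictionRigidityBelow` (lead c5, p160681 over L1 p152723, L2′ p153880, L3 p160397). What remains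
as HYPOTHESES are exactly the two open problems of the line and the route's target:
* S1 `IdentificationUpToKappa` — per mesh sequence `s → 0⁺` ONE `κ > 0` with every subsequential limit SLE_κ
  (the conformal half of the Lawler–Schramm–Werner conjecture; the recommended promote-stub of leads c2–c5);
* S4⁺ `LatticeAreaUpperBound` — the ONE-SIDED boundary rarity bound of the critical `ℤ²` SAW at a flat window
  (`P_δ[dist(x₀,γ) ≤ r]·ε₀² ≤ C·P_δ[dist ≤ ε₀]·r²`; surface two-leg exponent `≥ 2`);
* T′ `EventualTight` (stmt-CriticalPhenomena-1372, BY NAME).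
Deciding theorem (registered): `SubseqIdentification_of_dock_of_upperBound : S1 → S4⁺ → EventualTight → crux`.
Mechanism of the composition (kernel-checked): reference square and flat window (S2); subsequential limits in the
square and in the carved square `D₀ ∖ B̄(x₀, r)` at a radius `r` that is not an atom of `dist(x₀, trace)`
(`exists_radius_level_null`); the dock S1 gives ONE κ for all three limits; S4⁺ → S5⁺ → S6⁺ give `κ ≤ 8/3`; the
exact lattice restriction property passes to the limits (RS2a, RS2b, RS3); RS5 excludes `κ < 8/3`. No named fact.

References: G. F. Lawler, O. Schramm, W. Werner, *Conformal restriction: the chordal case* (2003); *On the scaling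
limit of planar self-avoiding walk* (2004); T. Alberts, M. Kozdron (2008); S. Rohde, O. Schramm (2005).
-/

noncomputable section

open MeasureTheory Filter Topology Set
open scoped NNReal ENNReal BoundedContinuousFunction
open Literature.Probability.RandomPlanarGeometry Literature.Probability.LatticeModels
open Literature.Probability.Process (preWienerMeasure)
open UpperHalfPlane (upperHalfPlaneSet)
open Summit.CriticalPhenomena.SAWScalingLimit.Theses.SAWParafermion (SubseqIdentification)
open Summit.CriticalPhenomena.SAWScalingLimit.Theses.SAWRenewalTightness (EventualTight)

namespace Summit.CriticalPhenomena.SAWScalingLimit.Theorems.SubseqIdentification.BoundaryAreaLaw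

/-- `c ↦ dist(x₀, trace c)` is `1`-Lipschitz on curve classes (pattern of the landed S5 file). [folklore] -/
theorem lipschitzWith_infDist_range_c4 (z : ℂ) :
    LipschitzWith 1 fun c : CurveClass ℂ => Metric.infDist z c.range := by
  refine LipschitzWith.of_le_add fun c₁ c₂ => ?_
  obtain ⟨γ₁, rfl⟩ := CurveClass.surjective_mk c₁
  obtain ⟨γ₂, rfl⟩ := CurveClass.surjective_mk c₂
  simp only [CurveClass.range_mk, CurveClass.dist_mk_mk]
  have key : ∀ ⦃y⦄, y ∈ γ₂.range → Metric.infDist z γ₁.range - dist γ₁ γ₂ ≤ dist z y := by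
    rintro y ⟨t, rfl⟩
    have h₁ := Curve.infDist_range_le γ₂ γ₁ t
    have h₂ := Metric.infDist_le_infDist_add_dist (s := γ₁.range) (x := z) (y := γ₂ t)
    rw [dist_comm γ₂ γ₁] at h₁
    linarith
  have h := (Metric.le_infDist γ₂.range_nonempty).2 key
  linarith

/-- **A good radius exists**: for a finite measure `ν` on curve classes, a point `x₀` and `ρ > 0` there is a radius
`0 < r` with `4 r ≤ ρ` which is not an atom of `c ↦ dist(x₀, trace c)` under `ν` (the atoms form a countable set,
`Measure.countable_meas_level_set_pos`, while `(0, ρ/4)` is uncountable). [folklore] -/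
theorem exists_radius_level_null (ν : Measure (CurveClass ℂ)) [IsFiniteMeasure ν] (x₀ : ℂ) {ρ : ℝ}
    (hρ : 0 < ρ) :
    ∃ r : ℝ, 0 < r ∧ 4 * r ≤ ρ ∧ ν {c | Metric.infDist x₀ c.range = r} = 0 := by
  have hmeas : Measurable fun c : CurveClass ℂ => Metric.infDist x₀ c.range :=
    (lipschitzWith_infDist_range_c4 x₀).continuous.measurable
  have hcount : Set.Countable {t : ℝ | 0 < ν {c : CurveClass ℂ | Metric.infDist x₀ c.range = t}} :=
    Measure.countable_meas_level_set_pos hmeas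
  have hunc : ¬ (Set.Ioo (0 : ℝ) (ρ / 4)).Countable := by
    rw [← Cardinal.le_aleph0_iff_set_countable, Cardinal.mk_Ioo_real (by positivity), not_le]
    exact Cardinal.aleph0_lt_continuum
  obtain ⟨r, hr, hrS⟩ : ∃ r ∈ Set.Ioo (0 : ℝ) (ρ / 4),
      r ∉ {t : ℝ | 0 < ν {c : CurveClass ℂ | Metric.infDist x₀ c.range = t}} :=
    Set.not_subset.1 fun h => hunc (hcount.mono h)
  refine ⟨r, hr.1, by linarith [hr.2], ?_⟩
  simpa only [Set.mem_setOf_eq, not_lt, nonpos_iff_eq_zero] using hrS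

/-- Windows shrink: the flat-window identity at radius `ρ` gives it at every `ρ' ≤ ρ`. [folklore] -/
theorem window_mono_c4 {V : Set ℂ} {x₀ : ℂ} {ρ ρ' : ℝ}
    (hwin : V ∩ Metric.ball x₀ ρ = {z : ℂ | x₀.im < z.im} ∩ Metric.ball x₀ ρ) (h : ρ' ≤ ρ) :
    V ∩ Metric.ball x₀ ρ' = {z : ℂ | x₀.im < z.im} ∩ Metric.ball x₀ ρ' := by
  have hsub : Metric.ball x₀ ρ ∩ Metric.ball x₀ ρ' = Metric.ball x₀ ρ' :=
    Set.inter_eq_self_of_subset_right (Metric.ball_subset_ball h)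
  rw [← hsub, ← Set.inter_assoc, hwin, Set.inter_assoc]

/-- **Composition of the restriction reshape `S1 → S2 → T′ → S4⁺ → S5⁺ → S6⁺ → RS2a → RS2b → RS3 → RS5 → SubseqIdentification`
(kernel-checked, no `sorry`).** Given the crux hypotheses for `(D; a, b)`, `s`, `μ`: take the reference window `(D₀; a₀, b₀)`,
`x₀`, `ρ₀` (S2) and shrink the radius below the distances to the marked points; extract a subsequential limit `ν₀` in `D₀`
along `s ∘ φ₀` (T′); pick a radius `r ∈ (0, ρ₁/4]` that is not an atom of `dist(x₀, trace)` under `ν₀`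
(`exists_radius_level_null`); carve `D₁ = D₀ ∖ B̄(x₀, r)` (RS2a), transfer the endpoint approximation and the lattice
nesting (RS2b), and extract a further subsequential limit `ν₁` in `D₁` along `s ∘ φ₀ ∘ φ₁` (T′). The dock (S1) along the
final subsequence gives ONE `κ` with `μ = SLE_κ(D)`, `ν₀ = SLE_κ(D₀)`, `ν₁ = SLE_κ(D₁)`; S4⁺ → S5⁺ → S6⁺ give `κ ≤ 8/3`; RS3
gives the restriction identity between `ν₁` and `ν₀` at radius `r`; if `κ ≠ 8/3`, RS5 (with `κ < 8/3`) refutes that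
identity — so `κ = 8/3` and `μ = SLE_{8/3}(D)`, the crux BY NAME. -/
theorem SubseqIdentification_of_restriction
    (h₁ : ∀ (s : ℕ → ℝ), Tendsto s atTop (𝓝[>] (0 : ℝ)) →
      ∃ κ : ℝ≥0, 0 < κ ∧
        ∀ (D : DobrushinDomain) (a b : ℝ → Site 2), SAW.IsEndpointApprox D a b →
          ∀ (μ : Measure (CurveClass ℂ)), IsProbabilityMeasure μ →
            (∀ f : CurveClass ℂ →ᵇ ℝ,
              Tendsto (fun n => ∫ γ, f γ.curve ∂(SAW.law D.carrier (s n) (a (s n)) (b (s n))))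
                atTop (𝓝 (∫ x, f x ∂μ))) →
            IsSLELaw κ D μ)
    (h₂ : ∃ (D₀ : DobrushinDomain) (a₀ b₀ : ℝ → Site 2) (x₀ : ℂ) (ρ₀ : ℝ),
      SAW.IsEndpointApprox D₀ a₀ b₀ ∧ 0 < ρ₀ ∧ x₀ ≠ D₀.pt 0 ∧ x₀ ≠ D₀.pt 1 ∧
        D₀.carrier ∩ Metric.ball x₀ ρ₀ = {z : ℂ | x₀.im < z.im} ∩ Metric.ball x₀ ρ₀)
    (h₃ : ∀ (D : DobrushinDomain) (a b : ℝ → Site 2), SAW.IsEndpointApprox D a b →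
      ∀ (s : ℕ → ℝ), Tendsto s atTop (𝓝[>] (0 : ℝ)) →
        ∃ φ : ℕ → ℕ, StrictMono φ ∧ ∃ μ : Measure (CurveClass ℂ), IsProbabilityMeasure μ ∧
          ∀ f : CurveClass ℂ →ᵇ ℝ,
            Tendsto (fun n => ∫ γ, f γ.curve
                ∂(SAW.law D.carrier (s (φ n)) (a (s (φ n))) (b (s (φ n)))))
              atTop (𝓝 (∫ x, f x ∂μ)))
    (h₄ : ∀ (D : DobrushinDomain) (a b : ℝ → Site 2), SAW.IsEndpointApprox D a b →
      ∀ (x₀ : ℂ) (ρ₀ : ℝ), 0 < ρ₀ →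
        D.carrier ∩ Metric.ball x₀ ρ₀ = {z : ℂ | x₀.im < z.im} ∩ Metric.ball x₀ ρ₀ →
        x₀ ≠ D.pt 0 → x₀ ≠ D.pt 1 →
        ∃ C ε₀ : ℝ, 0 < C ∧ 0 < ε₀ ∧ ∀ r : ℝ, 0 < r → r ≤ ε₀ →
          ∀ᶠ δ in 𝓝[>] (0 : ℝ),
            SAW.law D.carrier δ (a δ) (b δ) {γ | Metric.infDist x₀ γ.curve.range ≤ r} *
                ENNReal.ofReal (ε₀ ^ 2) ≤
              ENNReal.ofReal C *
                SAW.law D.carrier δ (a δ) (b δ) {γ | Metric.infDist x₀ γ.curve.range ≤ ε₀} *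
                  ENNReal.ofReal (r ^ 2))
    (h₅ : ∀ (D : DobrushinDomain) (a b : ℝ → Site 2) (s : ℕ → ℝ) (μ : Measure (CurveClass ℂ)) (x₀ : ℂ),
      Tendsto s atTop (𝓝[>] (0 : ℝ)) → IsProbabilityMeasure μ →
      (∀ f : CurveClass ℂ →ᵇ ℝ,
        Tendsto (fun n => ∫ γ, f γ.curve ∂(SAW.law D.carrier (s n) (a (s n)) (b (s n))))
          atTop (𝓝 (∫ x, f x ∂μ))) →
      (∃ C ε₀ : ℝ, 0 < C ∧ 0 < ε₀ ∧ ∀ r : ℝ, 0 < r → r ≤ ε₀ → ∀ᶠ n in atTop,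
          SAW.law D.carrier (s n) (a (s n)) (b (s n)) {γ | Metric.infDist x₀ γ.curve.range ≤ r} *
                ENNReal.ofReal (ε₀ ^ 2) ≤
              ENNReal.ofReal C *
                SAW.law D.carrier (s n) (a (s n)) (b (s n))
                    {γ | Metric.infDist x₀ γ.curve.range ≤ ε₀} *
                  ENNReal.ofReal (r ^ 2)) →
      ∃ C r₀ : ℝ, 0 < r₀ ∧ ∀ r ∈ Set.Ioo (0 : ℝ) r₀,
        μ {γ | Metric.infDist x₀ γ.range < r} ≤ ENNReal.ofReal (C * r ^ 2))
    (h₆ : ∀ (κ : ℝ≥0) (D : DobrushinDomain) (μ : Measure (CurveClass ℂ)) (x₀ : ℂ) (ρ₀ : ℝ),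
      0 < κ → IsSLELaw κ D μ → 0 < ρ₀ →
      D.carrier ∩ Metric.ball x₀ ρ₀ = {z : ℂ | x₀.im < z.im} ∩ Metric.ball x₀ ρ₀ →
      x₀ ≠ D.pt 0 → x₀ ≠ D.pt 1 →
      (∃ C r₀ : ℝ, 0 < r₀ ∧ ∀ r ∈ Set.Ioo (0 : ℝ) r₀,
          μ {γ | Metric.infDist x₀ γ.range < r} ≤ ENNReal.ofReal (C * r ^ 2)) →
      κ ≤ 8 / 3)
    (h₇ : ∀ (D : DobrushinDomain) (x₀ : ℂ) (ρ₀ r : ℝ), 0 < r → r < ρ₀ →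
      D.carrier ∩ Metric.ball x₀ ρ₀ = {z : ℂ | x₀.im < z.im} ∩ Metric.ball x₀ ρ₀ →
      ρ₀ ≤ dist x₀ (D.pt 0) → ρ₀ ≤ dist x₀ (D.pt 1) →
      ∃ D' : DobrushinDomain,
        D'.carrier = D.carrier \ Metric.closedBall x₀ r ∧ D'.pt 0 = D.pt 0 ∧ D'.pt 1 = D.pt 1)
    (h₈ : ∀ (D D' : DobrushinDomain) (a b : ℝ → Site 2) (x₀ : ℂ) (ρ₀ r : ℝ),
      SAW.IsEndpointApprox D a b → 0 < r → 4 * r ≤ ρ₀ →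
      D.carrier ∩ Metric.ball x₀ ρ₀ = {z : ℂ | x₀.im < z.im} ∩ Metric.ball x₀ ρ₀ →
      ρ₀ ≤ dist x₀ (D.pt 0) → ρ₀ ≤ dist x₀ (D.pt 1) →
      D'.carrier = D.carrier \ Metric.closedBall x₀ r → D'.pt 0 = D.pt 0 → D'.pt 1 = D.pt 1 →
      SAW.IsEndpointApprox D' a b ∧
        ∀ᶠ δ in 𝓝[>] (0 : ℝ),
          (∀ γ' : SAW.DomainSAW D'.carrier δ (a δ) (b δ),
              ∃ γ : SAW.DomainSAW D.carrier δ (a δ) (b δ), γ.walk.support = γ'.walk.support) ∧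
          (∀ γ : SAW.DomainSAW D.carrier δ (a δ) (b δ), r < Metric.infDist x₀ γ.curve.range →
              ∃ γ' : SAW.DomainSAW D'.carrier δ (a δ) (b δ), γ'.walk.support = γ.walk.support) ∧
          (∀ γ : SAW.DomainSAW D.carrier δ (a δ) (b δ),
              (∃ γ' : SAW.DomainSAW D'.carrier δ (a δ) (b δ), γ'.walk.support = γ.walk.support) →
              r ≤ Metric.infDist x₀ γ.curve.range))
    (h₉ : ∀ (Ω Ω' : Set ℂ) (a b : ℝ → Site 2) (s : ℕ → ℝ) (μ μ' : Measure (CurveClass ℂ)) (x₀ : ℂ) (r : ℝ),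
      Tendsto s atTop (𝓝[>] (0 : ℝ)) → IsProbabilityMeasure μ → IsProbabilityMeasure μ' →
      (∀ f : CurveClass ℂ →ᵇ ℝ,
        Tendsto (fun n => ∫ γ, f γ.curve ∂(SAW.law Ω (s n) (a (s n)) (b (s n))))
          atTop (𝓝 (∫ x, f x ∂μ))) →
      (∀ f : CurveClass ℂ →ᵇ ℝ,
        Tendsto (fun n => ∫ γ, f γ.curve ∂(SAW.law Ω' (s n) (a (s n)) (b (s n))))
          atTop (𝓝 (∫ x, f x ∂μ'))) →
      (∀ᶠ n in atTop,
          (∀ γ' : SAW.DomainSAW Ω' (s n) (a (s n)) (b (s n)),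
              ∃ γ : SAW.DomainSAW Ω (s n) (a (s n)) (b (s n)), γ.walk.support = γ'.walk.support) ∧
          (∀ γ : SAW.DomainSAW Ω (s n) (a (s n)) (b (s n)), r < Metric.infDist x₀ γ.curve.range →
              ∃ γ' : SAW.DomainSAW Ω' (s n) (a (s n)) (b (s n)), γ'.walk.support = γ.walk.support) ∧
          (∀ γ : SAW.DomainSAW Ω (s n) (a (s n)) (b (s n)),
              (∃ γ' : SAW.DomainSAW Ω' (s n) (a (s n)) (b (s n)), γ'.walk.support = γ.walk.support) →
              r ≤ Metric.infDist x₀ γ.curve.range)) →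
      μ {c | Metric.infDist x₀ c.range = r} = 0 →
      ∀ T : Set (CurveClass ℂ), MeasurableSet T →
        μ' T * μ {c | r ≤ Metric.infDist x₀ c.range} = μ (T ∩ {c | r ≤ Metric.infDist x₀ c.range}))
    (h₁₀ : ∀ (κ : ℝ≥0), 0 < κ → κ < 8 / 3 →
      ∀ (D D' : DobrushinDomain) (μ μ' : Measure (CurveClass ℂ)) (x₀ : ℂ) (ρ₀ r : ℝ),
        0 < r → r < ρ₀ →
        D.carrier ∩ Metric.ball x₀ ρ₀ = {z : ℂ | x₀.im < z.im} ∩ Metric.ball x₀ ρ₀ →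
        ρ₀ ≤ dist x₀ (D.pt 0) → ρ₀ ≤ dist x₀ (D.pt 1) →
        D'.carrier = D.carrier \ Metric.closedBall x₀ r → D'.pt 0 = D.pt 0 → D'.pt 1 = D.pt 1 →
        IsSLELaw κ D μ → IsSLELaw κ D' μ' →
        ¬ ∀ T : Set (CurveClass ℂ), MeasurableSet T →
            μ' T * μ {c | r ≤ Metric.infDist x₀ c.range} =
              μ (T ∩ {c | r ≤ Metric.infDist x₀ c.range})) :
    SubseqIdentification := by
  intro D a b hab s μ hs hμ hlim
  -- S2: the reference window; shrink its radius below the distances to the marked points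
  obtain ⟨D₀, a₀, b₀, x₀, ρ₀, hab₀, hρ₀, hx0, hx1, hwin⟩ := h₂
  set ρ₁ : ℝ := min ρ₀ (min (dist x₀ (D₀.pt 0)) (dist x₀ (D₀.pt 1))) with hρ₁def
  have hρ₁ : 0 < ρ₁ := lt_min hρ₀ (lt_min (dist_pos.2 hx0) (dist_pos.2 hx1))
  have hρ₁ρ₀ : ρ₁ ≤ ρ₀ := min_le_left _ _
  have hρ₁a : ρ₁ ≤ dist x₀ (D₀.pt 0) := (min_le_right _ _).trans (min_le_left _ _)
  have hρ₁b : ρ₁ ≤ dist x₀ (D₀.pt 1) := (min_le_right _ _).trans (min_le_right _ _)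
  have hwin₁ : D₀.carrier ∩ Metric.ball x₀ ρ₁ = {z : ℂ | x₀.im < z.im} ∩ Metric.ball x₀ ρ₁ :=
    window_mono_c4 hwin hρ₁ρ₀
  -- T′: a subsequential limit `ν₀` in the reference domain along `s ∘ φ₀`
  obtain ⟨φ₀, hφ₀, ν₀, hν₀, hlim₀⟩ := h₃ D₀ a₀ b₀ hab₀ s hs
  have hs₀ : Tendsto (s ∘ φ₀) atTop (𝓝[>] (0 : ℝ)) := hs.comp hφ₀.tendsto_atTop
  -- a good radius
  haveI := hν₀
  obtain ⟨r, hr0, hr4, hatom⟩ := exists_radius_level_null ν₀ x₀ hρ₁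
  have hrρ₁ : r < ρ₁ := by linarith
  -- RS2a/RS2b: the carved sub-domain, its endpoint approximation and lattice nesting
  obtain ⟨D₁, hcar, hpt0, hpt1⟩ := h₇ D₀ x₀ ρ₁ r hr0 hrρ₁ hwin₁ hρ₁a hρ₁b
  obtain ⟨hab₁, hnest⟩ := h₈ D₀ D₁ a₀ b₀ x₀ ρ₁ r hab₀ hr0 hr4 hwin₁ hρ₁a hρ₁b hcar hpt0 hpt1
  -- T′ again: a subsequential limit `ν₁` in the carved domain along `s ∘ φ₀ ∘ φ₁`
  obtain ⟨φ₁, hφ₁, ν₁, hν₁, hlim₁⟩ := h₃ D₁ a₀ b₀ hab₁ (s ∘ φ₀) hs₀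
  have hs₁ : Tendsto (s ∘ φ₀ ∘ φ₁) atTop (𝓝[>] (0 : ℝ)) := hs₀.comp hφ₁.tendsto_atTop
  have hlim₀' : ∀ f : CurveClass ℂ →ᵇ ℝ,
      Tendsto (fun n => ∫ γ, f γ.curve
          ∂(SAW.law D₀.carrier ((s ∘ φ₀ ∘ φ₁) n) (a₀ ((s ∘ φ₀ ∘ φ₁) n)) (b₀ ((s ∘ φ₀ ∘ φ₁) n))))
        atTop (𝓝 (∫ x, f x ∂ν₀)) :=
    fun f => (hlim₀ f).comp hφ₁.tendsto_atTop
  have hlim₁' : ∀ f : CurveClass ℂ →ᵇ ℝ,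
      Tendsto (fun n => ∫ γ, f γ.curve
          ∂(SAW.law D₁.carrier ((s ∘ φ₀ ∘ φ₁) n) (a₀ ((s ∘ φ₀ ∘ φ₁) n)) (b₀ ((s ∘ φ₀ ∘ φ₁) n))))
        atTop (𝓝 (∫ x, f x ∂ν₁)) := hlim₁
  -- S1: one `κ` along the final subsequence for `D`, `D₀` and `D₁`
  obtain ⟨κ, hκ, hdock⟩ := h₁ (s ∘ φ₀ ∘ φ₁) hs₁
  have hD : IsSLELaw κ D μ :=
    hdock D a b hab μ hμ fun f => ((hlim f).comp hφ₀.tendsto_atTop).comp hφ₁.tendsto_atTop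
  have hD₀ : IsSLELaw κ D₀ ν₀ := hdock D₀ a₀ b₀ hab₀ ν₀ hν₀ hlim₀'
  have hD₁ : IsSLELaw κ D₁ ν₁ := hdock D₁ a₀ b₀ hab₁ ν₁ hν₁ hlim₁'
  -- S4⁺ → S5⁺ → S6⁺: `κ ≤ 8/3`
  obtain ⟨C, ε₀, hC, hε₀, hlaw⟩ := h₄ D₀ a₀ b₀ hab₀ x₀ ρ₀ hρ₀ hwin hx0 hx1
  have hup := h₅ D₀ a₀ b₀ (s ∘ φ₀ ∘ φ₁) ν₀ x₀ hs₁ hν₀ hlim₀'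
    ⟨C, ε₀, hC, hε₀, fun r hr hrε => hs₁.eventually (hlaw r hr hrε)⟩
  have hκle : κ ≤ 8 / 3 := h₆ κ D₀ ν₀ x₀ ρ₀ hκ hD₀ hρ₀ hwin hx0 hx1 hup
  -- RS3: the restriction identity between `ν₁` and `ν₀` at radius `r`
  have hident := h₉ D₀.carrier D₁.carrier a₀ b₀ (s ∘ φ₀ ∘ φ₁) ν₀ ν₁ x₀ r hs₁ hν₀ hν₁ hlim₀' hlim₁'
    (hs₁.eventually hnest) hatom
  -- RS5: rigidity
  rcases eq_or_ne κ (8 / 3) with hk | hk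
  · rw [hk] at hD
    exact hD
  · exact absurd hident (h₁₀ κ hκ (lt_of_le_of_ne hκle hk) D₀ D₁ ν₀ ν₁ x₀ ρ₁ r hr0 hrρ₁ hwin₁
      hρ₁a hρ₁b hcar hpt0 hpt1 hD₀ hD₁)

/-- **THE CRUX FROM THE DOCK, THE ONE-SIDED LATTICE RARITY BOUND AND TIGHTNESS (registered deciding
theorem of the restriction composition of line `boundary-area-law`).** `IdentificationUpToKappa (S1) →
LatticeAreaUpperBound (S4⁺) → EventualTight (T′) → SubseqIdentification`, every other input discharged in the
tree. [cite: LawlerSchrammWerner2003Restriction, Prop. 5.3 and Thm. 6.5] -/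
theorem SubseqIdentification_of_dock_of_upperBound :
    (∀ (s : ℕ → ℝ), Tendsto s atTop (𝓝[>] (0 : ℝ)) →
      ∃ κ : ℝ≥0, 0 < κ ∧
        ∀ (D : DobrushinDomain) (a b : ℝ → Site 2), SAW.IsEndpointApprox D a b →
          ∀ (μ : Measure (CurveClass ℂ)), IsProbabilityMeasure μ →
            (∀ f : CurveClass ℂ →ᵇ ℝ,
              Tendsto (fun n => ∫ γ, f γ.curve ∂(SAW.law D.carrier (s n) (a (s n)) (b (s n))))
                atTop (𝓝 (∫ x, f x ∂μ))) →
            IsSLELaw κ D μ) →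
    (∀ (D : DobrushinDomain) (a b : ℝ → Site 2), SAW.IsEndpointApprox D a b →
      ∀ (x₀ : ℂ) (ρ₀ : ℝ), 0 < ρ₀ →
        D.carrier ∩ Metric.ball x₀ ρ₀ = {z : ℂ | x₀.im < z.im} ∩ Metric.ball x₀ ρ₀ →
        x₀ ≠ D.pt 0 → x₀ ≠ D.pt 1 →
        ∃ C ε₀ : ℝ, 0 < C ∧ 0 < ε₀ ∧ ∀ r : ℝ, 0 < r → r ≤ ε₀ →
          ∀ᶠ δ in 𝓝[>] (0 : ℝ),
            SAW.law D.carrier δ (a δ) (b δ) {γ | Metric.infDist x₀ γ.curve.range ≤ r} *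
                ENNReal.ofReal (ε₀ ^ 2) ≤
              ENNReal.ofReal C *
                SAW.law D.carrier δ (a δ) (b δ) {γ | Metric.infDist x₀ γ.curve.range ≤ ε₀} *
                  ENNReal.ofReal (r ^ 2)) →
    EventualTight → SubseqIdentification :=
  fun h₁ h₄ hT ↦ SubseqIdentification_of_restriction h₁ stub_referenceWindow (subseqLimitsExist_of_eventualTight hT) h₄
    stub_areaUpperOfLimit stub_kappaLeOfUpper stub_halfBallSubdomain stub_halfBallNesting stub_restrictionPassage
    stub_sleRestrictionRigidityBelow

/-- The same for the identical decl of route `SAWRenewalTightness` (the route owning `EventualTight`). -/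
theorem SubseqIdentification_renewalTightness_of_dock_of_upperBound :
    (∀ (s : ℕ → ℝ), Tendsto s atTop (𝓝[>] (0 : ℝ)) →
      ∃ κ : ℝ≥0, 0 < κ ∧
        ∀ (D : DobrushinDomain) (a b : ℝ → Site 2), SAW.IsEndpointApprox D a b →
          ∀ (μ : Measure (CurveClass ℂ)), IsProbabilityMeasure μ →
            (∀ f : CurveClass ℂ →ᵇ ℝ,
              Tendsto (fun n => ∫ γ, f γ.curve ∂(SAW.law D.carrier (s n) (a (s n)) (b (s n))))
                atTop (𝓝 (∫ x, f x ∂μ))) →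
            IsSLELaw κ D μ) →
    (∀ (D : DobrushinDomain) (a b : ℝ → Site 2), SAW.IsEndpointApprox D a b →
      ∀ (x₀ : ℂ) (ρ₀ : ℝ), 0 < ρ₀ →
        D.carrier ∩ Metric.ball x₀ ρ₀ = {z : ℂ | x₀.im < z.im} ∩ Metric.ball x₀ ρ₀ →
        x₀ ≠ D.pt 0 → x₀ ≠ D.pt 1 →
        ∃ C ε₀ : ℝ, 0 < C ∧ 0 < ε₀ ∧ ∀ r : ℝ, 0 < r → r ≤ ε₀ →
          ∀ᶠ δ in 𝓝[>] (0 : ℝ),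
            SAW.law D.carrier δ (a δ) (b δ) {γ | Metric.infDist x₀ γ.curve.range ≤ r} *
                ENNReal.ofReal (ε₀ ^ 2) ≤
              ENNReal.ofReal C *
                SAW.law D.carrier δ (a δ) (b δ) {γ | Metric.infDist x₀ γ.curve.range ≤ ε₀} *
                  ENNReal.ofReal (r ^ 2)) →
    EventualTight → Summit.CriticalPhenomena.SAWScalingLimit.Theses.SAWRenewalTightness.SubseqIdentification :=
  SubseqIdentification_of_dock_of_upperBound

end Summit.CriticalPhenomena.SAWScalingLimit.Theorems.SubseqIdentification.BoundaryAreaLaw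

end
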